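import Literature.Computability.Cryptography.HallgrenClassGroup
import Literature.Computability.Cryptography.HallgrenClassGroupQuantumKernel
import Literature.Computability.Cryptography.HallgrenClassGroupUniform
import Literature.Computability.Cryptography.HallgrenClassGroupPostFP
import Literature.Computability.QuantumComplexity.CWrapAssembly
import Literature.Computability.Complexity.BrickAlgebra
import HarnessLib

/-!
# Class numbers under GRH in quantum polynomial time: decomposition into "generators under GRH"
# and "subgroup order by a quantum algorithm"

Topic `Literature/Computability/Cryptography`; companion of `HallgrenClassGroup.lean` (the named fact
`Hallgren2005_classNumber_qsolvable_of_GRH`). The printed argument vendored there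
([ChildsVandam2010, §5.7]; [Hallgren2005, §4]) has exactly two steps:

1. "Assuming the generalized Riemann hypothesis (GRH), there is a polynomial-time algorithm to find
   generators of `Cl(K)` [Thi95]" — for `K = ℚ(√−d)`: under ERH the classes of the prime forms of
   norm `p < 6 log² d` generate the form class group ([Bach1990], remark after Thm. 4, p. 376:
   "the class group of a field of discriminant `Δ` is generated by the prime ideals of norm at most
   `12 log² Δ` … in the quadratic case … `6 log² Δ`"), and these forms (a square root of `−d`
   modulo `4p` for `p = O(log² d)`, then Gauss reduction) are listed in deterministic polynomial
   time;
2. "`Cl(K)` can be decomposed using the procedure of [Mos99, CM01]" / "a straightforward application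
   of the HSP for finite Abelian groups" ([Hallgren2005, §4]) — given generators with unique
   encodings (reduced forms) and a polynomial-time group law (composition and reduction), a quantum
   computer finds the structure, in particular the ORDER, of the generated group in polynomial time
   ([Kitaev1995, §3–§4]; [CheungMosca2001, §3]).

In the tree step 2 is far advanced (`HallgrenClassGroupQuantumKernel`: Kitaev's family
`kitaevClFamily` around a clean block computing the trial forms succeeds on every instance `(d, L)`
with probability `≥ 77/96`, `kernelProb_clOrderEst_ge`; the success analysis
`HallgrenClassGroupQuantumEstimates/Success`, the form class group of an arbitrary negative
discriminant `HallgrenClassGroupOrder*`, composition and reduction programmed in the polynomial-time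
algebra `CodeFP`, `HallgrenClassGroupComposeFP/ReduceFP/…`), and the classical-inside-quantum
wrapper is PROVED (`isQSolvable_classicalWrap_holds`, `CWrapAssembly`). This file names the two
printed steps as facts, in the instance format of `HallgrenClassGroupQuantumKernel`
(`encodeClInstance d L`, promise `IsClInstance d L`, answer `clGenOrder d L`), and PROVES the
assembly:

* `Hallgren2005.classGroupGenerators_mem_FP_of_GRH` — step 1;
* `Hallgren2005.subgroupOrder_qsolvable` — step 2 (unconditional);
* `Hallgren2005_classNumber_qsolvable_of_GRH_holds_of` — step 1 → step 2 → the named fact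
  (`isQSolvable_classicalWrap_holds` with the generator-lister as pre-processing and the projection
  `Brick.sndF` as post-processing, then `IsQSolvable.mono`).

(The seat's own line for the parent — a RANDOM-forms sampler justified by the proved GRH bound
`√d ≤ C·h(−d)·log d`, `HallgrenClassGroupGRHBound`, instead of Bach's generator bound — remains a
direct proof of the parent; the present decomposition follows the printed sources.)

## References

* [ChildsVandam2010] A. M. Childs, W. van Dam, *Quantum algorithms for algebraic problems*, Rev. Mod.
  Phys. 82 (2010), §5.7 (p. 24 of arXiv:0812.0380) and §IV.D.
* [Hallgren2005] S. Hallgren, *Fast quantum algorithms for computing the unit group and class group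
  of a number field*, STOC 2005, §4.
* [Bach1990] E. Bach, *Explicit bounds for primality testing and related problems*, Math. Comp. 55
  (1990) 355–380, Thm. 4 and the remark following it (p. 376).
* [Kitaev1995] A. Yu. Kitaev, *Quantum measurements and the Abelian Stabilizer Problem*,
  arXiv:quant-ph/9511026, §3–§4.
* [CheungMosca2001] K. K. H. Cheung, M. Mosca, *Decomposing finite abelian groups*, Quantum Inf.
  Comput. 1 (2001), §3.
-/

noncomputable section

namespace Literature.Computability.Cryptography

open _root_.Computability Literature.NumberTheory.LFunctions
open Literature.NumberTheory.QuadraticFields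
open Literature.Computability.Complexity Literature.Computability.QuantumComplexity

namespace Hallgren2005

/-- **Generators of the class group of an imaginary quadratic field in polynomial time, under GRH**
([ChildsVandam2010, §5.7]: "Assuming the generalized Riemann hypothesis (GRH), there is a
polynomial-time algorithm to find generators of `Cl(K)` [Thi95]"; the bound behind it is
[Bach1990], remark after Thm. 4, p. 376: under ERH "the class group of a field of discriminant `Δ`
is generated by the prime ideals of norm at most `12 log² Δ` … in the quadratic case … the prime
ideals of norm less than `6 log² Δ` generate the class group"). Tree form, in the instance format
of `HallgrenClassGroupQuantumKernel`: under the tree's `GrandRiemannHypothesisGL` there is a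
polynomial-time string function `h ∈ FP` which, on every input `bin(d)` with `−d` a negative
fundamental discriminant, outputs the code `encodeClInstance d L` of an instance — `L` a list of
reduced primitive positive definite forms of discriminant `−d` (`IsClInstance d L`) — whose forms
generate the whole form class group: the number `clGenOrder d L` of reduced forms generated by `L`
under composition (= the order of the subgroup of `Cl(−d)` generated by their classes,
`genOrder_eq_card_closure'`) equals the class number `h(−d)` (= `|Cl(𝓞_K)|`,
`IsNegFundamentalDiscr.classNumber_eq`). No requirement on other inputs. Proof sketch: list the
primes `p < 6 log² d` with `(−d | p) ≠ −1`, find `b` with `b² ≡ −d (mod 4p)` by exhaustion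
(`p = O(log² d)`), reduce `(p, b, (b² + d)/4p)` (`reduceGC`, `HallgrenClassGroupReduceFP`); the ERH
needed by [Bach1990] is that of the Hecke `L`-functions of the class-group characters of `K`, which
the Grand Riemann Hypothesis for `GL₂/ℚ` covers through automorphic induction
(`automorphicInduction_character`) — for the trivial character `HallgrenClassGroupERH` already
derives RH for `ζ_K` from `GrandRiemannHypothesisGL`.
[cite: Bach1990, Thm. 4 and remark p. 376] [cite: ChildsVandam2010, §5.7] -/
def classGroupGenerators_mem_FP_of_GRH : Prop :=
  GrandRiemannHypothesisGL →
    ∃ h ∈ FP, ∀ x : List Bool, IsNegFundamentalDiscr (decodeNat x) →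
      ∃ L : List (ℕ × ℤ × ℕ), h x = encodeClInstance (decodeNat x) L ∧
        IsClInstance (decodeNat x) L ∧
        clGenOrder (decodeNat x) L = BinaryQuadraticForm.classNumber (-(decodeNat x : ℤ))

/-- **The order of a subgroup of the form class group given by generators, in quantum polynomial
time** ([Hallgren2005, §4]: "computing the class group in this case is a straightforward
application of the HSP for finite Abelian groups"; [ChildsVandam2010, §5.7]: "`Cl(K)` can be
decomposed using the procedure of [Mos99, CM01]"; the procedure: [Kitaev1995, §3–§4] eigenvalue
estimation for the permutations `x ↦ g·x` of a black-box abelian group with unique encodings,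
[CheungMosca2001, §3]). Tree form (unconditional — no Riemann hypothesis enters this step): the
search problem "on input `encodeClInstance d L` satisfying the promise `IsClInstance d L` (`−d < 0`,
`−d ≡ 0, 1 (mod 4)`, `L` reduced primitive positive definite forms of discriminant `−d`), output
`bin(clGenOrder d L)`", the order of the subgroup of `Cl(−d)` generated by the classes of `L`
(`genOrder_eq_card_closure'`), is `IsQSolvable`: a `P`-uniform oracle-free Clifford+T family
outputs, with probability `≥ 2/3`, a string with that prefix (inputs that are not instance codes,
or violate the promise, carry no requirement; instance codes determine `(d, L)`,
`encodeClInstance_inj`). In the tree: Kitaev's family around any clean block computing the trial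
forms succeeds with probability `≥ 77/96` on every instance (`kernelProb_clOrderEst_ge`,
`HallgrenClassGroupQuantumKernel`); what remains is the reversible compilation of the block from
`composeGC`/`reduceGC` (`HallgrenClassGroupReduceFP`, cf. `ShorModExpBlock`), uniformity, and the
classical read-out `clOrderEst` as an `FP` post-processing (`isQSolvable_classicalWrap_holds`).
[cite: Kitaev1995, §3–§4] [cite: CheungMosca2001, §3] [cite: Hallgren2005, §4] -/
def subgroupOrder_qsolvable : Prop :=
  IsQSolvable fun w : List Bool =>
    {y | ∀ (d : ℕ) (L : List (ℕ × ℤ × ℕ)), w = encodeClInstance d L → IsClInstance d L →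
      encodeNat (clGenOrder d L) <+: y}

end Hallgren2005

/-- **Assembly ([ChildsVandam2010, §5.7]; [Hallgren2005, §4]): class numbers of imaginary quadratic
fields in quantum polynomial time under GRH, from the two printed steps.** Pre-process the input
`bin(d)` by the polynomial-time generator-lister `h` of
`Hallgren2005.classGroupGenerators_mem_FP_of_GRH`, run the quantum subgroup-order algorithm of
`Hallgren2005.subgroupOrder_qsolvable` on `h(bin d)`, and output its answer (post-processing = the
projection `Brick.sndF ∈ FP`): `isQSolvable_classicalWrap_holds` (classical computation inside a
uniform quantum family, PROVED in `CWrapAssembly`) and monotonicity `IsQSolvable.mono`, the answer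
`clGenOrder d L` being `h(−d)` because the listed forms generate.
[cite: ChildsVandam2010, §5.7] -/
theorem Hallgren2005_classNumber_qsolvable_of_GRH_holds_of
    (hG : Hallgren2005.classGroupGenerators_mem_FP_of_GRH)
    (hQ : Hallgren2005.subgroupOrder_qsolvable) :
    Hallgren2005_classNumber_qsolvable_of_GRH := by
  intro hGRH
  obtain ⟨h, hh, hspec⟩ := hG hGRH
  have hwrap := isQSolvable_classicalWrap_holds h Brick.sndF hh Brick.sndF_mem_FP hQ
  refine hwrap.mono fun x => ?_
  intro z hz hfund
  obtain ⟨y, hy, hyz⟩ := hz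
  obtain ⟨L, hxL, hinst, hgen⟩ := hspec x hfund
  rw [Brick.sndF_boolPair] at hyz
  have hy' : encodeNat (Hallgren2005.clGenOrder (decodeNat x) L) <+: y := hy (decodeNat x) L hxL hinst
  rw [hgen] at hy'
  exact hy'.trans hyz

namespace Hallgren2005

open QuantumComplexity Kitaev1995

/-- **Discharge of `subgroupOrder_qsolvable`: the order of a subgroup of the form class group given by
generators, in bounded-error quantum polynomial time** (Kitaev 1995, §4 p. 15: "we do `O(kn log(kn))`
elementary measurements `Ξ(V_j^{2^s})` with each register. The results of these measurements are
processed in a classical way … our procedure is uniform"; Cheung–Mosca 2001, §3; Hallgren 2005, §4: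
"a straightforward application of the HSP for finite Abelian groups"). The family is Kitaev's
`kitaevClFamily` around the clean block `ClBlock.VC` — the exact Clifford+T compilation of Bennett's
compute–copy–uncompute block of the polynomial-time machine of the trial forms
`reduce (∏_i slotForm_i^{E_{t,i}(c)})` (`HallgrenClassGroupBlockFP`, `HallgrenClassGroupBlock`: the
work register separates exactly the trial forms, `ClBlock.block_spec`), polynomial-time uniform
(`ClUniform.kitaevClFamily_isUniform`, `HallgrenClassGroupUniform`); on an instance its control
read-out lands with probability `≥ 77/96 > 2/3` in the read-outs with `clOrderEst = clGenOrder d L`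
(`kernelProb_clOrderEst_ge`, `HallgrenClassGroupQuantumKernel`); the classical post-processor
`ClPostFP.clPost` is polynomial time and computes `clOrderEst` (`HallgrenClassGroupPostFP`), and is
folded in by `isQSolvable_classicalWrap_holds` (Bernstein–Vazirani 1997, §8); off the promise nothing
is required. [cite: Kitaev1995, §4 p.15 (the algorithm for the ASP: eigenvalue measurements on l registers, classical post-processing, uniformity); CheungMosca2001, §3; Hallgren2005, §4] -/
theorem subgroupOrder_qsolvable_holds : subgroupOrder_qsolvable := by
  classical
  -- the raw relation solved by the family: "the post-processor outputs the order"
  let R₀ : List Bool → Set (List Bool) := fun w => {z | ∀ (d : ℕ) (L : List (ℕ × ℤ × ℕ)), w = encodeClInstance d L →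
    IsClInstance d L → ClPostFP.clPost (boolPair w z) = encodeNat (clGenOrder d L)}
  have h0 : IsQSolvable R₀ := by
    refine ⟨kitaevClFamily ClBlock.mWC ClBlock.VC, kitaevClFamily_isOracleFree ClBlock.VC_isOracleFree,
      ClUniform.kitaevClFamily_isUniform, fun w => ?_⟩
    by_cases hw : ∃ (d : ℕ) (L : List (ℕ × ℤ × ℕ)), w = encodeClInstance d L ∧ IsClInstance d L
    · obtain ⟨d, L, rfl, hinst⟩ := hw
      obtain ⟨R, hV, hR⟩ := ClBlock.block_spec d L hinst
      have heq : R₀ (encodeClInstance d L) = {z | clOrderEst (encodeClInstance d L).length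
          (clReadControls (encodeClInstance d L).length z) = clGenOrder d L} := by
        ext z
        simp only [Set.mem_setOf_eq, R₀, ClPostFP.clPost_boolPair]
        constructor
        · intro hz
          exact QCircuit.encodeNat_injective (hz d L rfl hinst)
        · intro hz d' L' hw' hinst'
          obtain ⟨rfl, rfl⟩ := encodeClInstance_inj hw'
          rw [hz]
      rw [heq]
      have := kernelProb_clOrderEst_ge d L hinst R hV hR
      linarith
    · have huniv : R₀ w = Set.univ := by
        ext z
        simp only [Set.mem_univ, iff_true, R₀, Set.mem_setOf_eq]
        intro d L hw' hinst
        exact absurd ⟨d, L, hw', hinst⟩ hw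
      rw [huniv, kernelProb_univ]
      norm_num
  -- wrap with the post-processor
  have h1 := isQSolvable_classicalWrap_holds id ClPostFP.clPost (PolyTimeComputable.id _) ClPostFP.clPost_mem_FP h0
  refine h1.mono fun w z' hz' => ?_
  obtain ⟨z, hz, hpre⟩ := hz'
  intro d L hw hinst
  exact (hz d L hw hinst) ▸ hpre

end Hallgren2005

end Literature.Computability.Cryptography

end
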